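import Literature.Computability.Complexity.SamplingDeviation
import HarnessLib

/-!
# Two-sided weak law of large numbers for iid trials from an arbitrary finite law (measure form)

Trunk T-CPLX-CORE, companion of `SamplingDeviation.lean` (uniform trials, counting form) and
`MajorityVote.lean`. Here the one-trial law is an ARBITRARY probability measure `μ` on a finite
outcome type `α` (e.g. `PMF.toMeasure` of a block of LWE samples with an arbitrary error law), and
the statement is about the product measure `μ^{⊗N}` on `Fin N → α`: the outcome sequences whose
number of good trials deviates from `N · μ(good)` by at least `N η` (`η > 0`) have probability at
most `1 / (4 N η²)` (`pi_measure_deviation_le`; Chebyshev: mean `N μ(good)`, variance `≤ N/4`).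
This is Kranakis's Theorem 3.5 (`Pr[|F_n(E) - p| ≥ ε] ≤ p(1-p)/(nε²) ≤ 1/(4nε²)`) for Bernoulli
trials obtained as indicators of an event under a general law — the form used by estimation steps
of reductions whose samples are not uniformly distributed (Regev 2009, §4, proof of Lemma 4.1:
"estimate the acceptance probability … by calling `W` … times", there with the Chernoff bound; the
Chebyshev bound suffices for inverse-polynomial error).

Proof: exactly as in `SamplingDeviation.lean` — Mathlib's Chebyshev inequality
`ProbabilityTheory.meas_ge_le_variance_div_sq` under `Measure.pi`, `variance_sum_pi`,
Bhatia–Davis `variance_le_sub_mul_sub` — with the uniform measure replaced by `μ`.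

## References

* E. Kranakis, *Primality and Cryptography*, Wiley–Teubner 1986, §3.5, Thm. 3.5 (Weak Law of
  Large Numbers, Bernoulli case) [Kranakis1986].
* S. Arora, B. Barak, *Computational Complexity: A Modern Approach*, CUP 2009, Lemma A.12
  (Chebyshev) [AroraBarak2009].
* O. Regev, *On lattices, learning with errors, random linear codes, and cryptography*, J. ACM 56
  (2009), §4, proof of Lemma 4.1 (the estimation step) [RegevLWE2009].
-/

namespace Literature.Computability.Complexity

open MeasureTheory ProbabilityTheory Finset

/-- **Weak law of large numbers, two-sided, for iid trials from a general finite law.** Let `μ` be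
a probability measure on a finite outcome type `α` (all singletons measurable) and `good` an event
of probability `p = μ(good)`. Under `N ≥ 1` independent trials of law `μ` (the product measure
`μ^{⊗N}` on `Fin N → α`), the outcome sequences in which the number of good trials deviates from
`N p` by at least `N η` (`η > 0`) have probability at most `1 / (4 N η²)` (Kranakis, Thm. 3.5:
`Pr[|F_n(E) - p| ≥ ε] ≤ 1/(4nε²)`). [cite: Kranakis1986, Thm. 3.5] -/
theorem pi_measure_deviation_le {α : Type*} [MeasurableSpace α] [MeasurableSingletonClass α]
    [Fintype α] (μ : Measure α) [IsProbabilityMeasure μ] (good : α → Prop) [DecidablePred good]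
    {N : ℕ} (hN : 0 < N) {η : ℝ} (hη : 0 < η) :
    Measure.pi (fun _ : Fin N => μ)
        {ω : Fin N → α | (N : ℝ) * η ≤
          |((univ.filter fun i => good (ω i)).card : ℝ) - N * μ.real {a | good a}|} ≤
      ENNReal.ofReal (1 / (4 * N * η ^ 2)) := by
  classical
  -- one trial: the indicator `X` of a good outcome
  have hgm : MeasurableSet {a : α | good a} := (Set.toFinite _).measurableSet
  set X : α → ℝ := {a : α | good a}.indicator 1 with hX
  have hXmeas : Measurable X := measurable_of_finite X
  have hXval : ∀ a, X a = if good a then 1 else 0 := fun a => by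
    simp only [hX, Set.indicator_apply, Set.mem_setOf_eq, Pi.one_apply]
  have hXbdd : ∀ᵐ a ∂μ, X a ∈ Set.Icc (0 : ℝ) 1 :=
    ae_of_all _ fun a => by rw [hXval]; split_ifs <;> simp
  have hXLp : MemLp X 2 μ := memLp_of_bounded hXbdd hXmeas.aestronglyMeasurable 2
  set p : ℝ := μ.real {a | good a} with hp
  -- its mean is `p`
  have hmean : μ[X] = p := by
    rw [hX, integral_indicator_one hgm]
  -- its variance is at most `1/4`
  have hvar : Var[X; μ] ≤ 1 / 4 := by
    have h := variance_le_sub_mul_sub hXbdd hXmeas.aemeasurable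
    nlinarith [h, sq_nonneg (μ[X] - 1 / 2)]
  -- `N` independent trials: the product measure, and the number `S` of good trials
  set P : Measure (Fin N → α) := Measure.pi fun _ : Fin N => μ with hP
  set S : (Fin N → α) → ℝ := ∑ i : Fin N, fun ω => X (ω i) with hS
  have hSLp : MemLp S 2 P := by
    refine memLp_finsetSum' _ fun i _ => ?_
    exact hXLp.comp_measurePreserving (measurePreserving_eval (fun _ : Fin N => μ) i)
  have hSvar : Var[S; P] ≤ N / 4 := by
    rw [hS, hP, variance_sum_pi fun _ => hXLp]
    calc ∑ _i : Fin N, Var[X; μ] ≤ ∑ _i : Fin N, (1 / 4 : ℝ) := Finset.sum_le_sum fun i _ => hvar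
      _ = N / 4 := by
          simp only [Finset.sum_const, Finset.card_univ, Fintype.card_fin]; ring
  have hSmean : P[S] = (N : ℝ) * p := by
    have hint : ∀ i : Fin N, ∫ ω, X (ω i) ∂P = μ[X] := fun i => by
      have hmp := measurePreserving_eval (fun _ : Fin N => μ) i
      rw [← hmp.map_eq, integral_map (measurable_pi_apply i).aemeasurable
        hXmeas.aestronglyMeasurable]
    have : P[S] = ∑ i : Fin N, ∫ ω, X (ω i) ∂P := by
      rw [hS, ← integral_finsetSum _ fun i _ => ?_]
      · simp only [Finset.sum_apply]
      · exact MemLp.integrable (by norm_num)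
          (hXLp.comp_measurePreserving (measurePreserving_eval (fun _ : Fin N => μ) i))
    rw [this]
    simp only [hint, hmean, Finset.sum_const, Finset.card_univ, Fintype.card_fin, nsmul_eq_mul]
  -- the deviation event IS the Chebyshev tail `{N η ≤ |S - E S|}`
  have hSval : ∀ ω, S ω = ((univ.filter fun i => good (ω i)).card : ℝ) := fun ω => by
    rw [hS, Finset.natCast_card_filter, Finset.sum_apply]
    exact Finset.sum_congr rfl fun i _ => hXval (ω i)
  have hsub : {ω : Fin N → α | (N : ℝ) * η ≤
      |((univ.filter fun i => good (ω i)).card : ℝ) - N * p|} ⊆ {ω | (N : ℝ) * η ≤ |S ω - P[S]|} := by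
    intro ω hω
    rw [Set.mem_setOf_eq, hSval ω, hSmean]
    exact hω
  have hcheb := meas_ge_le_variance_div_sq hSLp (c := (N : ℝ) * η) (by positivity)
  refine ((measure_mono hsub).trans hcheb).trans (ENNReal.ofReal_le_ofReal ?_)
  rw [div_le_div_iff₀ (by positivity) (by positivity)]
  have hN' : (1 : ℝ) ≤ N := by exact_mod_cast hN
  nlinarith [hSvar, sq_nonneg η, mul_pos (show (0:ℝ) < N by positivity) (sq_pos_of_pos hη)]

/-- **Strict-inequality / real-threshold form.** Same bound for the event that the count of good
trials is NOT within `N η` of `N μ(good)` (the complement of `|count - N p| < N η`).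
[cite: Kranakis1986, Thm. 3.5] -/
theorem pi_measure_not_lt_deviation_le {α : Type*} [MeasurableSpace α] [MeasurableSingletonClass α]
    [Fintype α] (μ : Measure α) [IsProbabilityMeasure μ] (good : α → Prop) [DecidablePred good]
    {N : ℕ} (hN : 0 < N) {η : ℝ} (hη : 0 < η) :
    Measure.pi (fun _ : Fin N => μ)
        {ω : Fin N → α | ¬ |((univ.filter fun i => good (ω i)).card : ℝ) - N * μ.real {a | good a}| <
          (N : ℝ) * η} ≤
      ENNReal.ofReal (1 / (4 * N * η ^ 2)) := by
  refine le_trans (measure_mono fun ω hω => ?_) (pi_measure_deviation_le μ good hN hη)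
  exact not_lt.1 hω

end Literature.Computability.Complexity
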